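import Summits.QuantumFields.YangMills.Theorems.AllWindowsColdBoxCubicChaosSecondMoment
import Mathlib.Analysis.Matrix.Order

/-!
# Variance bound for a trace-free cubic form of a centred Gaussian process: `E[V₃²] ≤ 6‖B‖²_{C⊗C⊗C}`
# — E(2), second half, of STUB-PLAN-E for stub E `stub_tiltMoments` of LINE-17 (crux `BoxMidWindowsSU22`, stmt-QuantumFields-24003)

Continuation of `…CubicChaosSecondMoment`: there `E[(Σ_{abc} B_{abc} X_aX_bX_c)²]` was identified with the sum over the six bipartite
pairings `Σ_σ ⟨B, B∘σ⟩_C`.  Here the positive-semidefiniteness of the two-point matrix `C` (hence of `C ⊗ C ⊗ C`, Mathlib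
`Matrix.PosSemidef.kronecker`) bounds each permuted Gram pairing by the straight one — `⟨B, B∘σ⟩_C ≤ ‖B‖²_C` from
`0 ≤ ‖B − B∘σ‖²_C` and `‖B∘σ‖_C = ‖B‖_C` (no square roots, no Cauchy–Schwarz needed) — giving the planner's inequality
`E[V₃²] ≤ 6 · Σ_{abc a'b'c'} B_{abc}B_{a'b'c'} C_{aa'}C_{bb'}C_{cc'}` (`integral_cubicForm_sq_le`; STUB-PLAN-E §2 E(2): «Var(V₃) ≤ 6‖B‖²_Γ»).
The tensor bookkeeping is done on the flattened index type `(κ × κ) × κ`, where `C ⊗ₖ C ⊗ₖ C` lives.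
Pure Mathlib + the sibling file; no definition.  HONEST LABEL: probabilistic helper for an open registered stub of a critic-passed line on the
R2ξ″ RECORD-rung crux 24003; no stub is proved by name, no crux, rung or summit is proved; the Yang–Mills mass gap is NOT proved by this.
-/

set_option autoImplicit false

noncomputable section

open MeasureTheory ProbabilityTheory Finset
open scoped Kronecker Matrix
open Literature.Probability.Distributions.GaussianWick

namespace Summit.QuantumFields.YangMills.Theorems.AllWindowsColdBox.CubicChaos

/-! ## The Gram form of `C ⊗ C ⊗ C` on 3-tensors, flattened to `(κ × κ) × κ` -/

section Gram

variable {κ : Type*} [Fintype κ]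

/-- `0 ≤ Σ_{pq} D_p D_q C_{p₁q₁}C_{p₂q₂}C_{p₃q₃}` for a positive semidefinite `C` (the Kronecker cube is positive semidefinite). -/
theorem gram3_nonneg (C : Matrix κ κ ℝ) (hC : C.PosSemidef) (D : (κ × κ) × κ → ℝ) :
    0 ≤ ∑ p, ∑ q, D p * D q * (C p.1.1 q.1.1 * C p.1.2 q.1.2 * C p.2 q.2) := by
  have hK := (hC.kronecker hC).kronecker hC
  have h := hK.dotProduct_mulVec_nonneg D
  have hq : star D ⬝ᵥ ((C ⊗ₖ C ⊗ₖ C) *ᵥ D) = ∑ p, ∑ q, D p * D q * (C p.1.1 q.1.1 * C p.1.2 q.1.2 * C p.2 q.2) := by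
    simp only [star_trivial, dotProduct, Matrix.mulVec, Matrix.kroneckerMap_apply, Finset.mul_sum]
    exact Finset.sum_congr rfl fun p _ => Finset.sum_congr rfl fun q _ => by ring
  rw [hq] at h
  exact h

/-- Symmetry of the Gram pairing (from the symmetry of `C`). -/
theorem gram3_symm (C : Matrix κ κ ℝ) (hsymm : ∀ a b, C a b = C b a) (D D' : (κ × κ) × κ → ℝ) :
    (∑ p, ∑ q, D p * D' q * (C p.1.1 q.1.1 * C p.1.2 q.1.2 * C p.2 q.2)) =
      ∑ p, ∑ q, D' p * D q * (C p.1.1 q.1.1 * C p.1.2 q.1.2 * C p.2 q.2) := by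
  rw [Finset.sum_comm]
  exact Finset.sum_congr rfl fun p _ => Finset.sum_congr rfl fun q _ => by
    rw [hsymm q.1.1 p.1.1, hsymm q.1.2 p.1.2, hsymm q.2 p.2]; ring

/-- `⟨D, D'⟩ ≤ ‖D‖²` when `‖D'‖ = ‖D‖`: from `0 ≤ ‖D − D'‖²`. -/
theorem gram3_inner_le (C : Matrix κ κ ℝ) (hC : C.PosSemidef) (D D' : (κ × κ) × κ → ℝ)
    (hN : (∑ p, ∑ q, D' p * D' q * (C p.1.1 q.1.1 * C p.1.2 q.1.2 * C p.2 q.2)) =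
      ∑ p, ∑ q, D p * D q * (C p.1.1 q.1.1 * C p.1.2 q.1.2 * C p.2 q.2)) :
    (∑ p, ∑ q, D p * D' q * (C p.1.1 q.1.1 * C p.1.2 q.1.2 * C p.2 q.2)) ≤
      ∑ p, ∑ q, D p * D q * (C p.1.1 q.1.1 * C p.1.2 q.1.2 * C p.2 q.2) := by
  have hsymm : ∀ a b, C a b = C b a := fun a b => by
    have h := hC.1.apply b a
    rwa [star_trivial] at h
  have h0 := gram3_nonneg C hC (fun p => D p - D' p)
  have hexp : (∑ p, ∑ q, (D p - D' p) * (D q - D' q) * (C p.1.1 q.1.1 * C p.1.2 q.1.2 * C p.2 q.2)) =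
      (∑ p, ∑ q, D p * D q * (C p.1.1 q.1.1 * C p.1.2 q.1.2 * C p.2 q.2)) -
        (∑ p, ∑ q, D p * D' q * (C p.1.1 q.1.1 * C p.1.2 q.1.2 * C p.2 q.2)) -
        (∑ p, ∑ q, D' p * D q * (C p.1.1 q.1.1 * C p.1.2 q.1.2 * C p.2 q.2)) +
        ∑ p, ∑ q, D' p * D' q * (C p.1.1 q.1.1 * C p.1.2 q.1.2 * C p.2 q.2) := by
    have : ∀ p q : (κ × κ) × κ, (D p - D' p) * (D q - D' q) * (C p.1.1 q.1.1 * C p.1.2 q.1.2 * C p.2 q.2) =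
        D p * D q * (C p.1.1 q.1.1 * C p.1.2 q.1.2 * C p.2 q.2) -
          D p * D' q * (C p.1.1 q.1.1 * C p.1.2 q.1.2 * C p.2 q.2) -
          D' p * D q * (C p.1.1 q.1.1 * C p.1.2 q.1.2 * C p.2 q.2) +
          D' p * D' q * (C p.1.1 q.1.1 * C p.1.2 q.1.2 * C p.2 q.2) := fun p q => by ring
    simp only [this, Finset.sum_add_distrib, Finset.sum_sub_distrib]
  rw [hexp, gram3_symm C hsymm D' D, hN] at h0
  linarith

/-- **A permuted Gram pairing is bounded by the straight one**: for a bijection `π` of the flattened triple index preserving the kernel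
`C ⊗ C ⊗ C` (any permutation of the three tensor slots), `Σ_{pq} D_p D_q K(p, π q) ≤ Σ_{pq} D_p D_q K(p, q)`. -/
theorem gram3_perm_le (C : Matrix κ κ ℝ) (hC : C.PosSemidef) (π : (κ × κ) × κ → (κ × κ) × κ) (hπ : Function.Bijective π)
    (hK : ∀ p q : (κ × κ) × κ, C (π p).1.1 (π q).1.1 * C (π p).1.2 (π q).1.2 * C (π p).2 (π q).2 =
      C p.1.1 q.1.1 * C p.1.2 q.1.2 * C p.2 q.2)
    (D : (κ × κ) × κ → ℝ) :
    (∑ p, ∑ q, D p * D q * (C p.1.1 (π q).1.1 * C p.1.2 (π q).1.2 * C p.2 (π q).2)) ≤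
      ∑ p, ∑ q, D p * D q * (C p.1.1 q.1.1 * C p.1.2 q.1.2 * C p.2 q.2) := by
  obtain ⟨g, hgl, hgr⟩ := Function.bijective_iff_has_inverse.1 hπ
  -- reindex the inner sum: `q ↦ π q`
  have h1 : ∀ p, (∑ q, D p * D q * (C p.1.1 (π q).1.1 * C p.1.2 (π q).1.2 * C p.2 (π q).2)) =
      ∑ q, D p * D (g q) * (C p.1.1 q.1.1 * C p.1.2 q.1.2 * C p.2 q.2) := fun p =>
    Fintype.sum_bijective π hπ _ _ fun q => by rw [hgl q]
  simp_rw [h1]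
  refine gram3_inner_le C hC D (fun q => D (g q)) ?_
  -- `‖D ∘ g‖ = ‖D‖`: reindex both sums by `π`
  symm
  refine Fintype.sum_bijective π hπ _ _ fun p => ?_
  refine Fintype.sum_bijective π hπ _ _ fun q => ?_
  rw [hgl p, hgl q, hK p q]

end Gram

/-! ## The variance bound -/

variable {T Ω : Type*} {mΩ : MeasurableSpace Ω} {P : Measure Ω} {X : T → Ω → ℝ}

/-- **`E[(Σ_{abc} B_{abc} X_aX_bX_c)²] ≤ 6 · Σ_{abc a'b'c'} B_{abc}B_{a'b'c'} C_{aa'}C_{bb'}C_{cc'}`** for a centred Gaussian process with positive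
semidefinite two-point matrix `C` on the legs and a 3-tensor `B` whose three partial `C`-traces vanish (STUB-PLAN-E §2 E(2)). -/
theorem integral_cubicForm_sq_le (hX : IsGaussianProcess X P) (h0 : ∀ s, ∫ ω, X s ω ∂P = 0)
    {κ : Type*} [Fintype κ] (t : κ → T) (C : Matrix κ κ ℝ) (hC : C.PosSemidef)
    (hCX : ∀ a b, C a b = ∫ ω, X (t a) ω * X (t b) ω ∂P)
    (B : κ → κ → κ → ℝ) (hB12 : ∀ c, (∑ a, ∑ b, B a b c * C a b) = 0) (hB13 : ∀ b, (∑ a, ∑ c, B a b c * C a c) = 0)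
    (hB23 : ∀ a, (∑ b, ∑ c, B a b c * C b c) = 0) :
    ∫ ω, (∑ a, ∑ b, ∑ c, B a b c * (X (t a) ω * X (t b) ω * X (t c) ω)) ^ 2 ∂P ≤
      6 * ∑ a, ∑ b, ∑ c, ∑ a', ∑ b', ∑ c', B a b c * B a' b' c' * (C a a' * C b b' * C c c') := by
  rw [integral_cubicForm_sq hX h0 t C hCX B hB12 hB13 hB23]
  -- split the six pairings
  have hsplit : ∀ a b c a' b' c', B a b c * B a' b' c' *
      (C a a' * (C b b' * C c c' + C b c' * C c b') + C a b' * (C b a' * C c c' + C b c' * C c a') +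
        C a c' * (C b a' * C c b' + C b b' * C c a')) =
      B a b c * B a' b' c' * (C a a' * C b b' * C c c') + B a b c * B a' b' c' * (C a a' * C b c' * C c b') +
        B a b c * B a' b' c' * (C a b' * C b a' * C c c') + B a b c * B a' b' c' * (C a b' * C b c' * C c a') +
        B a b c * B a' b' c' * (C a c' * C b a' * C c b') + B a b c * B a' b' c' * (C a c' * C b b' * C c a') := by
    intros; ring
  rw [sum6_congr hsplit]
  simp only [Finset.sum_add_distrib]
  -- flatten to `(κ × κ) × κ`
  have hflat : ∀ K : κ → κ → κ → κ → κ → κ → ℝ,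
      (∑ a, ∑ b, ∑ c, ∑ a', ∑ b', ∑ c', B a b c * B a' b' c' * K a b c a' b' c') =
        ∑ p : (κ × κ) × κ, ∑ q : (κ × κ) × κ, B p.1.1 p.1.2 p.2 * B q.1.1 q.1.2 q.2 *
          K p.1.1 p.1.2 p.2 q.1.1 q.1.2 q.2 := fun K => by
    simp only [Fintype.sum_prod_type]
  rw [hflat fun a b c a' b' c' => C a a' * C b b' * C c c', hflat fun a b c a' b' c' => C a a' * C b c' * C c b',
    hflat fun a b c a' b' c' => C a b' * C b a' * C c c', hflat fun a b c a' b' c' => C a b' * C b c' * C c a',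
    hflat fun a b c a' b' c' => C a c' * C b a' * C c b', hflat fun a b c a' b' c' => C a c' * C b b' * C c a']
  -- the five nontrivial slot permutations, as bijections of `(κ × κ) × κ`
  have i23 : Function.Bijective fun q : (κ × κ) × κ => ((q.1.1, q.2), q.1.2) :=
    Function.Involutive.bijective fun q => rfl
  have i12 : Function.Bijective fun q : (κ × κ) × κ => ((q.1.2, q.1.1), q.2) :=
    Function.Involutive.bijective fun q => rfl
  have i13 : Function.Bijective fun q : (κ × κ) × κ => ((q.2, q.1.2), q.1.1) :=
    Function.Involutive.bijective fun q => rfl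
  have icyc : Function.Bijective fun q : (κ × κ) × κ => ((q.2, q.1.1), q.1.2) :=
    Function.bijective_iff_has_inverse.2 ⟨fun q => ((q.1.2, q.2), q.1.1), fun q => rfl, fun q => rfl⟩
  have icyc2 : Function.Bijective fun q : (κ × κ) × κ => ((q.1.2, q.2), q.1.1) :=
    Function.bijective_iff_has_inverse.2 ⟨fun q => ((q.2, q.1.1), q.1.2), fun q => rfl, fun q => rfl⟩
  have h2 := gram3_perm_le C hC _ i23 (fun p q => by ring) fun p => B p.1.1 p.1.2 p.2
  have h3 := gram3_perm_le C hC _ i12 (fun p q => by ring) fun p => B p.1.1 p.1.2 p.2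
  have h4 := gram3_perm_le C hC _ icyc2 (fun p q => by ring) fun p => B p.1.1 p.1.2 p.2
  have h5 := gram3_perm_le C hC _ icyc (fun p q => by ring) fun p => B p.1.1 p.1.2 p.2
  have h6 := gram3_perm_le C hC _ i13 (fun p q => by ring) fun p => B p.1.1 p.1.2 p.2
  simp only at h2 h3 h4 h5 h6
  linarith

end Summit.QuantumFields.YangMills.Theorems.AllWindowsColdBox.CubicChaos

end
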